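import Summits.PneNP.PneNP.Theorems.BruckRyserSosSosBlindPlanesMoments

/-!
# PneNP / BruckRyserSos — the template grid inside a board; splitting sums over lines; transport

Route `PneNP/BruckRyserSos`, crux stmt-PneNP-16761 (`SosBlindPlanes`); companion of file
`…Moments`.

* `emb`, `down`, `gridSet` — the standard copy of the template points/lines inside a board with
  `D ≤ v` points, and a left inverse;
* `addLine W A B = W ∪ A × {B}` — "the points of `A` lie on the line `B`", the shape in which the
  design identities multiply a monomial;
* `sum_addLine_emb` — the SPLIT of `Σ_B δ (τ₀ ∪ A × {B})` over all board lines `B`, for a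
  board-invariant `δ` and an embedded template `τ₀`: the lines of `τ₀` plus `v - |lns τ₀|` copies
  of the value at one fresh line (all fresh lines give the same value, by invariance);
* `exists_transport` — any board configuration with few points and lines, together with a marked
  set of points, is moved by a board symmetry onto an embedded template leaving a template line
  free.

These two lemmas reduce the (infinitely many, `v`-dependent) board identities to finitely many
template identities (file `…Identities`).

References: folklore (symmetry reduction of moment relaxations, cf. M. Laurent, Math. Oper. Res.
28 (2003)).
-/

set_option linter.dupNamespace false -- `Summit.PneNP.PneNP.…`: summit = sub-problem name (D-0017 single-conjunct layout)

noncomputable section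

namespace Summit.PneNP.PneNP.Theorems.SosBlindPlanes

open Finset Function

variable {v v' D : ℕ}

/-! ### The template grid inside a board -/

/-- The standard embedding of the template points/lines into a board with `D ≤ v`. [folklore] -/
abbrev emb (hDv : D ≤ v) : Fin D → Fin v :=
  Fin.castLE hDv

/-- A left inverse of the standard embedding (`0 < D`). [folklore] -/
def down (hD : 0 < D) (k : Fin v) : Fin D :=
  if h : k.val < D then ⟨k.val, h⟩ else ⟨0, hD⟩

/-- `down` is a left inverse of `emb`. [folklore] -/
theorem down_emb (hD : 0 < D) (hDv : D ≤ v) (k : Fin D) : down hD (emb hDv k) = k := by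
  simp [down, emb, k.2]

/-- `emb ∘ down` is the identity on the grid. [folklore] -/
theorem emb_down (hD : 0 < D) (hDv : D ≤ v) {k : Fin v} (hk : k.val < D) :
    emb hDv (down hD k) = k := by
  ext; simp [down, emb, hk]

/-- The grid embedding is injective. [folklore] -/
theorem emb_injective (hDv : D ≤ v) : Function.Injective (emb hDv) :=
  Fin.castLE_injective hDv

/-- The image of the template grid inside the board. [folklore] -/
def gridSet (hDv : D ≤ v) : Finset (Fin v) :=
  univ.image (emb hDv)

/-- The grid has `D` points. [folklore] -/
theorem card_gridSet (hDv : D ≤ v) : (gridSet hDv).card = D := by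
  rw [gridSet, card_image_of_injective _ (emb_injective hDv), card_univ, Fintype.card_fin]

/-- Membership in the grid. [folklore] -/
theorem mem_gridSet_iff (hDv : D ≤ v) {k : Fin v} : k ∈ gridSet hDv ↔ k.val < D := by
  simp only [gridSet, mem_image, mem_univ, true_and]
  constructor
  · rintro ⟨j, rfl⟩; simp [emb]
  · intro hk; exact ⟨⟨k.val, hk⟩, by ext; simp [emb]⟩

/-- `down` is injective on subsets of the grid. [folklore] -/
theorem injOn_down (hD : 0 < D) (hDv : D ≤ v) {s : Finset (Fin v)} (hs : s ⊆ gridSet hDv) :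
    Set.InjOn (down hD) (s : Set (Fin v)) := by
  intro x hx y hy hxy
  have hx' := (mem_gridSet_iff hDv).1 (hs hx)
  have hy' := (mem_gridSet_iff hDv).1 (hs hy)
  rw [← emb_down hD hDv hx', ← emb_down hD hDv hy', hxy]

/-- A board configuration inside the grid is the embedding of a template of the same size.
[folklore] -/
theorem rel_emb_down (hD : 0 < D) (hDv : D ≤ v) {U : Finset (Fin v × Fin v)}
    (hP : pts U ⊆ gridSet hDv) (hL : lns U ⊆ gridSet hDv) :
    rel (emb hDv) (emb hDv) (rel (down hD) (down hD) U) = U :=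
  rel_rel_eq_self (fun _ hp => emb_down hD hDv ((mem_gridSet_iff hDv).1 (hP hp)))
    (fun _ hq => emb_down hD hDv ((mem_gridSet_iff hDv).1 (hL hq)))

/-! ### Adding one line through a set of points; the split of a sum over lines -/

/-- `W` together with the cells `(a, B)`, `a ∈ A`: "the points of `A` lie on the line `B`".
[folklore] -/
def addLine {m : ℕ} (W : Finset (Fin m × Fin m)) (A : Finset (Fin m)) (B : Fin m) :
    Finset (Fin m × Fin m) :=
  W ∪ A ×ˢ {B}

/-- Relabeling commutes with `addLine`. [folklore] -/
theorem rel_addLine {m m' : ℕ} (f g : Fin m → Fin m') (W : Finset (Fin m × Fin m))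
    (A : Finset (Fin m)) (B : Fin m) :
    rel f g (addLine W A B) = addLine (rel f g W) (A.image f) (g B) := by
  simp only [addLine, rel_union]
  congr 1
  ext c
  simp only [mem_rel, mem_product, mem_singleton, mem_image]
  constructor
  · rintro ⟨c', ⟨h1, h2⟩, rfl⟩
    exact ⟨⟨c'.1, h1, rfl⟩, by rw [h2]⟩
  · rintro ⟨⟨x, hx, hx'⟩, h2⟩
    refine ⟨(x, B), ⟨hx, rfl⟩, ?_⟩
    ext <;> simp [hx', h2]

/-- The lines of `addLine W A B` are lines of `W` or `B`. [folklore] -/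
theorem lns_addLine_subset {m : ℕ} (W : Finset (Fin m × Fin m)) (A : Finset (Fin m)) (B : Fin m) :
    lns (addLine W A B) ⊆ insert B (lns W) := by
  intro q hq
  rw [addLine, lns_union] at hq
  rcases mem_union.1 hq with h | h
  · exact mem_insert_of_mem h
  · obtain ⟨p, hp⟩ := mem_lns.1 h
    rw [mem_product, mem_singleton] at hp
    exact hp.2 ▸ mem_insert_self _ _

/-- The points of `addLine W A B` are points of `W` or of `A`. [folklore] -/
theorem pts_addLine_subset {m : ℕ} (W : Finset (Fin m × Fin m)) (A : Finset (Fin m)) (B : Fin m) :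
    pts (addLine W A B) ⊆ pts W ∪ A := by
  intro p hp
  rw [addLine, pts_union] at hp
  rcases mem_union.1 hp with h | h
  · exact mem_union_left _ h
  · obtain ⟨q, hq⟩ := mem_pts.1 h
    rw [mem_product] at hq
    exact mem_union_right _ hq.1

/-- `addLine W A B` has at most `|W| + |A|` cells. [folklore] -/
theorem card_addLine_le {m : ℕ} (W : Finset (Fin m × Fin m)) (A : Finset (Fin m)) (B : Fin m) :
    (addLine W A B).card ≤ W.card + A.card := by
  refine (card_union_le _ _).trans ?_
  rw [card_product, card_singleton, mul_one]

/-- A functional on board configurations invariant under the board symmetry group. [folklore] -/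
def BoardInv (δ : Finset (Fin v × Fin v) → ℝ) : Prop :=
  ∀ (σ τ : Equiv.Perm (Fin v)) (U : Finset (Fin v × Fin v)), δ (rel σ τ U) = δ U

/-- **Split of the sum over all lines.** For an invariant board functional, an embedded template
`τ₀`, template points `A` and a template line `B⋆` not used by `τ₀`: summing
`δ (τ₀ ∪ A × {B})` over ALL board lines `B` gives the lines of `τ₀` plus `v - |lns τ₀|` copies of
the value at the fresh line `B⋆`. [folklore] -/
theorem sum_addLine_emb {δ : Finset (Fin v × Fin v) → ℝ} (hδ : BoardInv δ) (hDv : D ≤ v)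
    (τ₀ : Finset (Fin D × Fin D)) (A : Finset (Fin D)) {Bs : Fin D} (hBs : Bs ∉ lns τ₀) :
    ∑ B : Fin v, δ (addLine (rel (emb hDv) (emb hDv) τ₀) (A.image (emb hDv)) B) =
      ∑ B₀ ∈ lns τ₀, δ (rel (emb hDv) (emb hDv) (addLine τ₀ A B₀)) +
        ((v : ℝ) - (lns τ₀).card) * δ (rel (emb hDv) (emb hDv) (addLine τ₀ A Bs)) := by
  classical
  set ι := emb hDv with hι
  set S₁ : Finset (Fin v) := (lns τ₀).image ι with hS₁
  set F : Fin v → ℝ := fun B => δ (addLine (rel ι ι τ₀) (A.image ι) B) with hF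
  have hιinj : Function.Injective ι := emb_injective hDv
  -- the lines of `τ₀`
  have h1 : ∑ B ∈ S₁, F B = ∑ B₀ ∈ lns τ₀, δ (rel ι ι (addLine τ₀ A B₀)) := by
    rw [hS₁, sum_image (fun x _ y _ h => hιinj h)]
    refine sum_congr rfl fun B₀ _ => ?_
    simp only [hF, rel_addLine]
  -- the fresh lines all give the value at `Bs`
  have h2 : ∀ B ∈ univ \ S₁, F B = δ (rel ι ι (addLine τ₀ A Bs)) := by
    intro B hB
    have hB' : B ∉ S₁ := (mem_sdiff.1 hB).2
    -- relabel lines by `ι` updated at `Bs ↦ B`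
    let g' : Fin D → Fin v := Function.update ι Bs B
    have hg'τ : ∀ q ∈ lns τ₀, g' q = ι q := by
      intro q hq
      have : q ≠ Bs := fun h => hBs (h ▸ hq)
      simp [g', this]
    have hrel : rel ι g' (addLine τ₀ A Bs) = addLine (rel ι ι τ₀) (A.image ι) B := by
      rw [rel_addLine]
      congr 1
      · exact rel_congr (fun p _ => rfl) hg'τ
      · simp [g']
    have hinj : Set.InjOn g' (lns (addLine τ₀ A Bs)) := by
      intro x hx y hy hxy
      have hx' := lns_addLine_subset τ₀ A Bs hx
      have hy' := lns_addLine_subset τ₀ A Bs hy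
      rcases mem_insert.1 hx' with rfl | hx'' <;> rcases mem_insert.1 hy' with rfl | hy''
      · rfl
      · exfalso
        rw [hg'τ y hy''] at hxy
        simp only [g', update_self] at hxy
        exact hB' (hxy ▸ mem_image_of_mem _ hy'')
      · exfalso
        rw [hg'τ x hx''] at hxy
        simp only [g', update_self] at hxy
        exact hB' (hxy ▸ mem_image_of_mem _ hx'')
      · rw [hg'τ x hx'', hg'τ y hy''] at hxy
        exact hιinj hxy
    obtain ⟨σ, τ, hστ⟩ := exists_perm_rel_eq (addLine τ₀ A Bs) hιinj.injOn hιinj.injOn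
      hιinj.injOn hinj
    simp only [hF]
    rw [← hrel, ← hστ, hδ]
  have hS₁sub : S₁ ⊆ univ := subset_univ _
  rw [← sum_sdiff hS₁sub, h1, sum_congr rfl h2, sum_const, card_sdiff_of_subset hS₁sub, card_univ,
    Fintype.card_fin, hS₁, card_image_of_injective _ hιinj, nsmul_eq_mul, add_comm]
  congr 1
  rw [Nat.cast_sub]
  exact (card_le_univ (lns τ₀)).trans (by simpa using hDv)

/-! ### Transport of a board configuration into the grid -/

/-- **Transport.** A board configuration `U` and a nonempty set `A` of points, with at most `D`
points in total and fewer than `D ≤ v` lines, are moved by a board symmetry onto an embedded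
template `τ₀`, embedded template points `A₀`, leaving a template line `B⋆` unused by `τ₀`.
[folklore] -/
theorem exists_transport (hD : 0 < D) (hDv : D ≤ v) (U : Finset (Fin v × Fin v))
    (A : Finset (Fin v)) (hA : A.Nonempty) (hP : (pts U ∪ A).card ≤ D) (hL : (lns U).card < D) :
    ∃ (σ τ : Equiv.Perm (Fin v)) (τ₀ : Finset (Fin D × Fin D)) (A₀ : Finset (Fin D)) (Bs : Fin D),
      rel σ τ U = rel (emb hDv) (emb hDv) τ₀ ∧ A.image σ = A₀.image (emb hDv) ∧ Bs ∉ lns τ₀ ∧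
        τ₀.card = U.card ∧ A₀.card = A.card := by
  classical
  set ι := emb hDv with hι
  have hιinj : Function.Injective ι := emb_injective hDv
  -- a board line not used by `U`
  obtain ⟨B₁, hB₁⟩ : ∃ B₁ : Fin v, B₁ ∉ lns U := by
    by_contra hcon
    push Not at hcon
    have : (univ : Finset (Fin v)) ⊆ lns U := fun x _ => hcon x
    have := card_le_card this
    rw [card_univ, Fintype.card_fin] at this
    omega
  -- move `U ∪ A × {B₁}` into the grid
  set Up := addLine U A B₁ with hUp
  have hPp : (pts Up).card ≤ (gridSet hDv).card := by
    rw [card_gridSet]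
    exact (card_le_card (pts_addLine_subset U A B₁)).trans hP
  have hLp : (lns Up).card ≤ (gridSet hDv).card := by
    rw [card_gridSet]
    refine (card_le_card (lns_addLine_subset U A B₁)).trans ?_
    exact (card_insert_le _ _).trans hL
  obtain ⟨σ, τ, hσP, hσL⟩ := exists_perm_rel_subset Up (gridSet hDv) (gridSet hDv) hPp hLp
  have hUsub : U ⊆ Up := subset_union_left
  have hPU : pts (rel σ τ U) ⊆ gridSet hDv := (pts_mono (rel_mono σ τ hUsub)).trans hσP
  have hLU : lns (rel σ τ U) ⊆ gridSet hDv := (lns_mono (rel_mono σ τ hUsub)).trans hσL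
  have hAσ : A.image σ ⊆ gridSet hDv := by
    intro x hx
    obtain ⟨p, hp, rfl⟩ := mem_image.1 hx
    apply hσP
    rw [pts_rel]
    exact mem_image_of_mem _ (mem_pts.2 ⟨B₁, by simp [hUp, addLine, hp]⟩)
  have hτB₁ : τ B₁ ∈ gridSet hDv := by
    apply hσL
    rw [lns_rel]
    obtain ⟨p, hp⟩ := hA
    exact mem_image_of_mem _ (mem_lns.2 ⟨p, by simp [hUp, addLine, hp]⟩)
  refine ⟨σ, τ, rel (down hD) (down hD) (rel σ τ U), (A.image σ).image (down hD), down hD (τ B₁),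
    (rel_emb_down hD hDv hPU hLU).symm, ?_, ?_, ?_, ?_⟩
  · rw [image_image]
    symm
    conv_rhs => rw [← image_id (s := A.image σ)]
    apply image_congr
    intro x hx
    exact emb_down hD hDv ((mem_gridSet_iff hDv).1 (hAσ (mem_coe.1 hx)))
  · intro hmem
    rw [lns_rel, lns_rel] at hmem
    obtain ⟨y, hy, hyeq⟩ := mem_image.1 hmem
    obtain ⟨q, hq, rfl⟩ := mem_image.1 hy
    have hτq : τ q ∈ gridSet hDv := hLU (by rw [lns_rel]; exact mem_image_of_mem _ hq)
    have := injOn_down hD hDv (s := gridSet hDv) (Subset.refl _) hτq hτB₁ hyeq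
    exact hB₁ (τ.injective this ▸ hq)
  · rw [card_rel (injOn_down hD hDv hPU) (injOn_down hD hDv hLU),
      card_rel σ.injective.injOn τ.injective.injOn]
  · rw [card_image_of_injOn (injOn_down hD hDv hAσ), card_image_of_injective _ σ.injective]

end Summit.PneNP.PneNP.Theorems.SosBlindPlanes
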